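import Literature.MathematicalPhysics.QuantumFieldTheory.Balaban1983to89.B9CoReadingCoordsS
import Literature.MathematicalPhysics.QuantumFieldTheory.Balaban1983to89.B9IndexBondFaithful
import Literature.MathematicalPhysics.QuantumFieldTheory.Balaban1983to89.B9CarrierBlockMultiplicity

/-!
# `Balaban1983to89.B9MultiscaleSmoothPartitionY` — THE MULTISCALE SMOOTH PARTITION OF UNITY `{ζ_y}_{y}` ON def-Y's TORUS SITES, indexed by the
# INDEX BONDS `y` (the sites of `geo9K i`), subordinate to the enlarged carrier blocks `Δ̃(y)`: `Σ_y ζ_y = 1`, `0 ≤ ζ_y ≤ 1`, `supp ζ_y ⊂ Δ̃(y)`, and the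
# member-uniform SCALE-LIPSCHITZ bound `|ζ_y(z) − ζ_y(z′)| ≤ C·|z − z′|_T ∕ L^{j(y)}` — the datum of the (F1) smooth-partition block norms

T. Bałaban, *Propagators for lattice gauge theories in a background field*, Commun. Math. Phys. **99** (1985) 389–434
[`Balaban1985BackgroundPropagators`, "B9"]; [4] = T. Bałaban, *Propagators and renormalization transformations for lattice gauge
theories. II*, Commun. Math. Phys. **96** (1984) 223–250 [`Balaban1984PropagatorsII`].

statement-level skeleton of published theorems with citation tags; proofs where landed; nothing here is a claim about the
Yang–Mills mass gap

THE PRINTED LOCI.  [B9] (3.43)–(3.45) p. 398: the Hölder members of Theorem 3.3 are localised by smooth cut-offs *"ζ ∈ C₀^∞(Δ̃(y))"* with the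
cost *"(‖ζ‖^ξ_α + |ζ|)"* (ζ measured in units of the block scale `ξ = Lʲη`), inputs *"supp λ ⊂ Δ̃(y′)"*; [4] (2.51)–(2.52) p. 232 (*"Σ_y Δ(y) = I"*, the block
majorants) and p. 239 before (2.89) (*"the partition of unity {h_□²} and the corresponding family of functions ζ_□ ∈ C₀^∞(□̃)"*).  Print never spells the
multiscale family `{ζ_y}_{y∈𝔅}` out; on a lattice only FIRST differences of `ζ_y` are ever used ((3.43)'s `‖ζ‖^ξ_α`), so a piecewise-linear (tent)
profile is a faithful reading.

WHY THIS FILE (cell `pub-ymgap`, node N06, seat dag-n06-l g20).  The located architecture item of the N06 certificate («SHARP-CUT JUMPS», n06-w6 g1;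
«bH13 ∕ bXH ∕ hκX», n06-l g18∕g19): a Hölder-type INTERMEDIATE of rows 20–21 (`bH13`, `bXH`) can be produced, consumed and cut member-uniformly only in a
SMOOTH-PARTITION block norm — n06-w6's generic `B11SectGSmoothCut.BlockNorm.ofSmoothPartition`, whose one remaining datum is a partition of unity `ζ` on
the carrier with: `Σ_y ζ y x = 1`, `0 ≤ ζ ≤ 1`, `ζ y` vanishing off a neighbourhood `N y`, and a scale-Lipschitz bound.  THIS FILE constructs that datum at
def-Y's k-level torus index `i : KIdx` ON THE SITES `SiteY i`, indexed by the index bonds `IBondY i = (geo9K i).Site`: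
* §1 the tent profile `prof t = max 0 (min 1 (3 − t))` (`= 1` for `t ≤ 2`, `= 0` for `t ≥ 3`, 1-Lipschitz);
* §2 the radial coordinate `rad i y z = dist_T(z, centre of β y) ∕ L^{j(y)}` on the real torus (`B6Geom246MultiLevelTorus.posT ∕ toT`) and the tent
  `tent i y z = prof (rad i y z)`: `0 ≤ tent ≤ 1`, `= 1` on the carrier block `β y` and its touching blocks of level `≤ j(y)`, `= 0` unless
  `rad < 3`, `|tent y z − tent y z′| ≤ |z − z′|_T ∕ L^{j(y)}`;
* §3 ★ the two-level window at a site ((2.2) `TDomains.sepT`, `R ≥ 2L ≥ 6`): `|z − t|_T ≤ 6·L^{lev t} ⇒ |lev z − lev t| ≤ 1`; hence `rad i y z ≤ 11∕2 ⇒ |lev z − j(y)| ≤ 1`;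
* §4 ★ COVERAGE: `1 ≤ tot i z := Σ_y tent i y z` — by n06-l∕n06-d's faithful block map (`B9IndexBondFaithful.exists_faithful_kIdx`: an index bond of the
  level of `z` whose carrier block touches the block of `z`), although ORPHAN blocks (blocks that carry no index bond, `B9GlobReadingOrphan`) exist;
* §5 ★★ THE PARTITION `zeta i y z := tent i y z ∕ tot i z`: `Σ_y zeta i y z = 1`, `0 ≤ zeta ≤ 1`, `zeta y z ≠ 0 ⇒ rad i y z < 3` (`NearY`), and the pull-back
  `zetaOn π` to any carrier with a site projection (e.g. n06-d's `XSK κ i`, `π = Prod.fst`).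
The member-uniform SCALE-LIPSCHITZ bound of `zeta` (per-level packing `packT` × carrier multiplicity `card_sameCarrier_le_kIdx` for the number of active
tents, then the quotient rule) is the sequel `B9MultiscaleSmoothPartitionYLip`.
HONEST SCOPE.  Finite-lattice geometry of ONE k-level torus family at a time ([4] (2.1)–(2.2)); the radii `2, 3` (in units of `L^{j(y)}`) and the window
constant `6` are ours; nothing of [B9]∕[4] is asserted; no pin of any certificate binder, no schema; COUNT-NEUTRAL; N06 NOT discharged; nothing continuum,
nothing about the mass gap.  Cell `pub-ymgap` (HUMAN RULING D-0062), Track A node N06 [B9], seat `pub-ymgap-dag-n06-l` (g20), 2026-08-28.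
-/

noncomputable section

namespace Literature.MathematicalPhysics.QuantumFieldTheory.Balaban1983to89.B9MultiscaleSmoothPartitionY

open B4TorusKernel.MultiPeriod (torusSupNorm torusSupNorm_nonneg)
open B6MultiLevelBoxOperator (N0 bigSide one_le_bigSide)
open B6MultiLevelTorusOperator (one_le_N0 TDomains)
open B6Geom246MultiLevelBox (bset blkOf exists_blkOf_eq lev_eq_of_blkOf_eq toR)
open B6Geom246MultiLevelTorus (TPt toT posT dist_toT_toR dist_site_posT_le dist_posT_le_of_touchT TouchT bondT bondT_adj torusSupNorm_neg geomT)
open B6Ineq2142KLevelV1 (β lvl beta_level)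
open B6KLevelCensusIndexV1 (KIdx)
open B9GeoLemma21KLevelV1 (one_le_k)
open B9CoReadingCoordsS (sIK blkV1_site)
open Node00 (SiteY FBondY IBondY BlkY toKT)

variable {d ℓ : ℕ} {hd : 1 ≤ d + 1} {hL : Odd (ℓ + 1) ∧ 1 < ℓ + 1} {b₀ b₁ : ℝ}

/-! ## §1 The tent profile -/

/-- the tent profile `max 0 (min 1 (3 − t))`: `1` on `t ≤ 2`, `0` on `t ≥ 3`, linear in between. OURS (print: `ζ ∈ C₀^∞(Δ̃(y))`; on a lattice only
first differences are read). [cite: Balaban1985BackgroundPropagators, (3.43) p.398 («ζ ∈ C₀^∞(Δ̃(y))»), dictionary] -/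
def prof (t : ℝ) : ℝ := max 0 (min 1 (3 - t))

/-- `0 ≤ prof`. [cite: Balaban1985BackgroundPropagators, (3.43) p.398, bookkeeping] -/
theorem prof_nonneg (t : ℝ) : 0 ≤ prof t := le_max_left _ _

/-- `prof ≤ 1`. [cite: Balaban1985BackgroundPropagators, (3.43) p.398, bookkeeping] -/
theorem prof_le_one (t : ℝ) : prof t ≤ 1 := max_le zero_le_one (min_le_left _ _)

/-- `prof t = 1` for `t ≤ 2`. [cite: Balaban1985BackgroundPropagators, (3.43) p.398, bookkeeping] -/
theorem prof_eq_one {t : ℝ} (h : t ≤ 2) : prof t = 1 := by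
  unfold prof; rw [min_eq_left (by linarith), max_eq_right zero_le_one]

/-- `prof t = 0` for `3 ≤ t`. [cite: Balaban1985BackgroundPropagators, (3.43) p.398, bookkeeping] -/
theorem prof_eq_zero {t : ℝ} (h : 3 ≤ t) : prof t = 0 := by
  unfold prof; rw [max_eq_left]; exact min_le_of_right_le (by linarith)

/-- `prof t ≠ 0` forces `t < 3`. [cite: Balaban1985BackgroundPropagators, (3.43) p.398, bookkeeping] -/
theorem lt_three_of_prof_ne_zero {t : ℝ} (h : prof t ≠ 0) : t < 3 := by
  by_contra h3; exact h (prof_eq_zero (not_lt.1 h3))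

/-- the profile is 1-Lipschitz. [cite: Balaban1985BackgroundPropagators, (3.43) p.398 («‖ζ‖^ξ_α»), bookkeeping] -/
theorem abs_prof_sub_le (a b : ℝ) : |prof a - prof b| ≤ |a - b| := by
  unfold prof
  calc |max 0 (min 1 (3 - a)) - max 0 (min 1 (3 - b))| ≤ max |(0 : ℝ) - 0| |min 1 (3 - a) - min 1 (3 - b)| := abs_max_sub_max_le_max _ _ _ _
    _ ≤ max |(0 : ℝ) - 0| (max |(1 : ℝ) - 1| |(3 - a) - (3 - b)|) := max_le_max le_rfl (abs_min_sub_min_le_max _ _ _ _)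
    _ = |a - b| := by
        rw [sub_self, sub_self, abs_zero, show (3 - a) - (3 - b) = -(a - b) by ring, abs_neg, max_eq_right (abs_nonneg (a - b)),
          max_eq_right (abs_nonneg (a - b))]

/-! ## §2 The radial coordinate of a site about a carrier block and the tent of an index bond -/

section Tent

variable (i : KIdx d ℓ hd hL b₀ b₁)

/-- the block scale `L^{j(y)}` of an index bond (lattice units). [cite: Balaban1984PropagatorsII, (2.1) p.224 («Lʲη»), dictionary] -/
def scl (y : IBondY i) : ℝ := (((ℓ + 1 : ℕ) : ℝ)) ^ (lvl i.hN i.D i.hk y)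

/-- `0 < L^{j(y)}`. [cite: Balaban1984PropagatorsII, (2.1) p.224, bookkeeping] -/
theorem scl_pos (y : IBondY i) : 0 < scl i y := by unfold scl; positivity

/-- `1 ≤ L^{j(y)}`. [cite: Balaban1984PropagatorsII, (2.1) p.224, bookkeeping] -/
theorem one_le_scl (y : IBondY i) : 1 ≤ scl i y := by
  unfold scl; exact one_le_pow₀ (by exact_mod_cast Nat.succ_le_succ (Nat.zero_le ℓ))

/-- the class of a box-chart site on the real torus `Π_μ ℝ∕N₀_μℤ`. [cite: Balaban1983RegularityDecay, p.572 (T_η), dictionary] -/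
def pt (z : SiteY i) : TPt (toKT i).NB := toT (toKT i).NB (toR z.1)

/-- the position of the carrier block `β y` on the real torus (class of its centre). [cite: Balaban1984PropagatorsII, (2.46) p.231, dictionary] -/
def ctr (y : IBondY i) : TPt (toKT i).NB := posT (toKT i).D (β i.hN i.D i.hk y)

/-- **the radial coordinate** of a site about the carrier block of `y`, in units of `L^{j(y)}`: `dist_T(z, centre(β y)) ∕ L^{j(y)}`.
[cite: Balaban1985BackgroundPropagators, (3.43) p.398 («Δ̃(y)»); Balaban1984PropagatorsII, (2.46) p.231, dictionary] -/
def rad (y : IBondY i) (z : SiteY i) : ℝ := dist (pt i z) (ctr i y) / scl i y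

/-- `0 ≤ rad`. [cite: Balaban1985BackgroundPropagators, (3.43) p.398, bookkeeping] -/
theorem rad_nonneg (y : IBondY i) (z : SiteY i) : 0 ≤ rad i y z := div_nonneg dist_nonneg (scl_pos i y).le

/-- the torus sup-distance of two box-chart sites IS the distance of their classes on the real torus. [cite: Balaban1983RegularityDecay, p.572, dictionary] -/
theorem dist_pt (z z' : SiteY i) : dist (pt i z) (pt i z') = torusSupNorm (toKT i).NB (z.1 - z'.1) :=
  dist_toT_toR (fun μ => one_le_N0 (toKT i).hMh (toKT i).hP μ) _ _

/-- the radial coordinates of two sites differ by at most `|z − z′|_T ∕ L^{j(y)}`. [cite: Balaban1984PropagatorsII, (2.46) p.231, bookkeeping] -/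
theorem abs_rad_sub_le (y : IBondY i) (z z' : SiteY i) : |rad i y z - rad i y z'| ≤ torusSupNorm (toKT i).NB (z.1 - z'.1) / scl i y := by
  rw [rad, rad, ← sub_div, abs_div, abs_of_pos (scl_pos i y), ← dist_pt]
  exact div_le_div_of_nonneg_right (abs_dist_sub_le _ _ _) (scl_pos i y).le

/-- ★ **THE TENT OF AN INDEX BOND**: `prof (rad i y z)` — `1` within `2L^{j(y)}` of the centre of `β y`, `0` beyond `3L^{j(y)}`.
[cite: Balaban1985BackgroundPropagators, (3.43) p.398 («ζ ∈ C₀^∞(Δ̃(y))»); Balaban1984PropagatorsII, p.239 («ζ_□ ∈ C₀^∞(□̃)»)] -/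
def tent (y : IBondY i) (z : SiteY i) : ℝ := prof (rad i y z)

/-- `0 ≤ tent`. [cite: Balaban1985BackgroundPropagators, (3.43) p.398, bookkeeping] -/
theorem tent_nonneg (y : IBondY i) (z : SiteY i) : 0 ≤ tent i y z := prof_nonneg _

/-- `tent ≤ 1`. [cite: Balaban1985BackgroundPropagators, (3.43) p.398, bookkeeping] -/
theorem tent_le_one (y : IBondY i) (z : SiteY i) : tent i y z ≤ 1 := prof_le_one _

/-- `tent = 1` within radial coordinate `2`. [cite: Balaban1985BackgroundPropagators, (3.43) p.398, bookkeeping] -/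
theorem tent_eq_one_of_rad_le {y : IBondY i} {z : SiteY i} (h : rad i y z ≤ 2) : tent i y z = 1 := prof_eq_one h

/-- `tent ≠ 0` forces radial coordinate `< 3`. [cite: Balaban1985BackgroundPropagators, (3.43) p.398 («supp ζ ⊂ Δ̃(y)»), bookkeeping] -/
theorem rad_lt_three_of_tent_ne_zero {y : IBondY i} {z : SiteY i} (h : tent i y z ≠ 0) : rad i y z < 3 := lt_three_of_prof_ne_zero h

/-- ★ **THE TENT IS SCALE-LIPSCHITZ**: `|tent y z − tent y z′| ≤ |z − z′|_T ∕ L^{j(y)}`. [cite: Balaban1985BackgroundPropagators, (3.43) p.398 («‖ζ‖^ξ_α»)] -/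
theorem abs_tent_sub_le (y : IBondY i) (z z' : SiteY i) : |tent i y z - tent i y z'| ≤ torusSupNorm (toKT i).NB (z.1 - z'.1) / scl i y :=
  (abs_prof_sub_le _ _).trans (abs_rad_sub_le i y z z')

end Tent

/-! ## §3 The two-level window at a site ((2.2) on the torus) -/

section Window

variable (i : KIdx d ℓ hd hL b₀ b₁)

include hL in
/-- `3 ≤ L` (`L = ℓ + 1` is odd and `> 1`). [cite: Balaban1984PropagatorsII, (2.1) p.224, bookkeeping] -/
theorem three_le_L : 3 ≤ ℓ + 1 := by obtain ⟨m, hm⟩ := hL.1; have := hL.2; omega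

/-- the arithmetic of (2.2): `6·L^j ≤ R·(M_h·L^{n+1})` for `j ≤ n + 1` (`R ≥ 2L ≥ 6`, `M_h ≥ 1`). [cite: Balaban1984PropagatorsII, (2.2) p.224, bookkeeping] -/
theorem six_mul_pow_le_R_bigSide {j n : ℕ} (hn : j ≤ n + 1) :
    6 * (((ℓ + 1 : ℕ) : ℝ)) ^ j ≤ (((toKT i).R * bigSide ℓ (toKT i).Mh n : ℕ) : ℝ) := by
  have hR6 : 6 ≤ (toKT i).R := le_trans (by have := three_le_L (hL := hL); omega) (toKT i).hR
  have hnat : 6 * (ℓ + 1) ^ j ≤ (toKT i).R * bigSide ℓ (toKT i).Mh n := by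
    unfold bigSide
    calc 6 * (ℓ + 1) ^ j ≤ 6 * (ℓ + 1) ^ (n + 1) := Nat.mul_le_mul_left 6 (Nat.pow_le_pow_right (by omega) hn)
      _ ≤ (toKT i).R * ((toKT i).Mh * (ℓ + 1) ^ (n + 1)) :=
          Nat.mul_le_mul hR6 (Nat.le_mul_of_pos_left _ (lt_of_lt_of_le Nat.zero_lt_one (toKT i).hMh))
  have hcast : (((6 * (ℓ + 1) ^ j : ℕ)) : ℝ) = 6 * (((ℓ + 1 : ℕ) : ℝ)) ^ j := by push_cast; ring
  rw [← hcast]; exact_mod_cast hnat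

/-- ★ **THE TWO-LEVEL WINDOW AT A SITE**: a site within torus distance `6·L^{lev t}` of a site `t` has level `lev t − 1`, `lev t` or `lev t + 1` —
(2.2) `dist_T(Ω_j^c, Ω_{j+1}) > R·M·Lʲ` read at the levels `lev t − 1` and `lev t + 1`. [cite: Balaban1984PropagatorsII, (2.2) p.224 with p.230 («intersecting maybe the domain B^{j+1}(Λ_{j+1})»)] -/
theorem levY_window {z t : SiteY i} (h : torusSupNorm (toKT i).NB (z.1 - t.1) ≤ 6 * (((ℓ + 1 : ℕ) : ℝ)) ^ Node00.levY i t) :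
    Node00.levY i t ≤ Node00.levY i z + 1 ∧ Node00.levY i z ≤ Node00.levY i t + 1 := by
  constructor
  · by_contra hlt
    push Not at hlt
    have hsep := (toKT i).D.sepT (Node00.levY i t - 1) z.1 z.2 t.1 t.2 (by unfold Node00.levY at hlt ⊢; omega)
      (by unfold Node00.levY at hlt ⊢; omega)
    have hle := six_mul_pow_le_R_bigSide i (j := Node00.levY i t) (n := Node00.levY i t - 1) (by omega)
    linarith
  · by_contra hlt
    push Not at hlt
    have hsep := (toKT i).D.sepT (Node00.levY i t + 1) t.1 t.2 z.1 z.2 (by unfold Node00.levY; omega)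
      (by unfold Node00.levY at hlt ⊢; omega)
    rw [show t.1 - z.1 = -(z.1 - t.1) by abel, torusSupNorm_neg (fun μ => one_le_N0 (toKT i).hMh (toKT i).hP μ)] at hsep
    have hle := six_mul_pow_le_R_bigSide i (j := Node00.levY i t) (n := Node00.levY i t + 1) (by omega)
    linarith

/-- a site of the carrier block `β y`: it has level `j(y)` and lies within `(L^{j(y)} − 1)∕2` of the centre. [cite: Balaban1984PropagatorsII, (2.45) p.231, bookkeeping] -/
theorem exists_site_of_carrier (y : IBondY i) :
    ∃ t : SiteY i, blkOf i.D.toDomains t = β i.hN i.D i.hk y ∧ Node00.levY i t = lvl i.hN i.D i.hk y ∧ dist (pt i t) (ctr i y) ≤ (scl i y - 1) / 2 := by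
  obtain ⟨t, ht⟩ := exists_blkOf_eq (toKT i).D.toDomains (β i.hN i.D i.hk y)
  refine ⟨t, ht, (lev_eq_of_blkOf_eq _ ht).trans (beta_level i.hN i.D i.hk (one_le_k i) y), ?_⟩
  have h := dist_site_posT_le (D := (toKT i).D) ht
  rw [beta_level i.hN i.D i.hk (one_le_k i) y, Nat.cast_pow] at h
  exact h

/-- ★ a site within radial coordinate `r` of a carrier block is within torus distance `(r + 1∕2)·L^{j(y)}` of a SITE of the block (the input of the
«enlargement adapters»: from there the block of `z` is `O(1)` admissible bonds away from `β y`). [cite: Balaban1985BackgroundPropagators, (3.43) p.398 («Δ̃(y)»); Balaban1984PropagatorsII, (2.46) p.231] -/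
theorem exists_site_of_rad_le {y : IBondY i} {z : SiteY i} {r : ℝ} (h : rad i y z ≤ r) :
    ∃ t : SiteY i, blkOf i.D.toDomains t = β i.hN i.D i.hk y ∧ Node00.levY i t = lvl i.hN i.D i.hk y ∧
      torusSupNorm (toKT i).NB (z.1 - t.1) ≤ (r + 1 / 2) * scl i y := by
  obtain ⟨t, hbt, hlt, hdt⟩ := exists_site_of_carrier i y
  refine ⟨t, hbt, hlt, ?_⟩
  have hs := scl_pos i y
  have hz : dist (pt i z) (ctr i y) ≤ r * scl i y := by rwa [rad, div_le_iff₀ hs] at h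
  rw [← dist_pt]
  calc dist (pt i z) (pt i t) ≤ dist (pt i z) (ctr i y) + dist (pt i t) (ctr i y) := dist_triangle_right _ _ _
    _ ≤ r * scl i y + (scl i y - 1) / 2 := add_le_add hz hdt
    _ ≤ (r + 1 / 2) * scl i y := by linarith

/-- ★ **A SITE WITHIN RADIAL COORDINATE `11∕2` OF A CARRIER BLOCK HAS LEVEL `j(y) − 1`, `j(y)` OR `j(y) + 1`** (it is within `6L^{j(y)}` of a site of `β y`).
[cite: Balaban1984PropagatorsII, (2.2) p.224; Balaban1985BackgroundPropagators, (3.43) p.398 («Δ̃(y)»)] -/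
theorem levY_window_of_rad_le {y : IBondY i} {z : SiteY i} (h : rad i y z ≤ 11 / 2) :
    lvl i.hN i.D i.hk y ≤ Node00.levY i z + 1 ∧ Node00.levY i z ≤ lvl i.hN i.D i.hk y + 1 := by
  obtain ⟨t, -, hlt, hdt⟩ := exists_site_of_rad_le i h
  have hzt : torusSupNorm (toKT i).NB (z.1 - t.1) ≤ 6 * (((ℓ + 1 : ℕ) : ℝ)) ^ Node00.levY i t := by
    rw [hlt]; refine hdt.trans (le_of_eq ?_); rw [scl]; ring
  rw [← hlt]; exact levY_window i hzt

/-- in particular where the tent of `y` does not vanish. [cite: Balaban1984PropagatorsII, (2.2) p.224; Balaban1985BackgroundPropagators, (3.43) p.398] -/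
theorem levY_window_of_tent_ne_zero {y : IBondY i} {z : SiteY i} (h : tent i y z ≠ 0) :
    lvl i.hN i.D i.hk y ≤ Node00.levY i z + 1 ∧ Node00.levY i z ≤ lvl i.hN i.D i.hk y + 1 :=
  levY_window_of_rad_le i ((rad_lt_three_of_tent_ne_zero i h).le.trans (by norm_num))

end Window

/-! ## §4 Coverage: some tent of the level of `z` equals `1` at `z` (orphan blocks notwithstanding) -/

section Coverage

variable (i : KIdx d ℓ hd hL b₀ b₁)

/-- the level of a site is the level of its block. [cite: Balaban1984PropagatorsII, (2.45) p.231, bookkeeping] -/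
theorem levY_eq_blkOf (z : SiteY i) : Node00.levY i z = (blkOf i.D.toDomains z).1.1 :=
  lev_eq_of_blkOf_eq i.D.toDomains rfl

/-- blocks at graph distance `≤ 1` in the torus bond graph are equal or touch, so their positions are at most `L^{max level}` apart.
[cite: Balaban1984PropagatorsII, (2.46) p.231, bookkeeping] -/
theorem dist_posT_le_of_dist_le_one {s t : BlkY i} (h : (geomT i.D).dist s t ≤ 1) :
    dist (posT (toKT i).D s) (posT (toKT i).D t) ≤ (((ℓ + 1 : ℕ) : ℝ)) ^ max s.1.1 t.1.1 := by
  have hreach : (bondT i.D).Reachable s t := (B6Geom246MultiLevelTorus.connectedT (toKT i).hMh (toKT i).hP).preconnected s t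
  have hnat : (bondT i.D).dist s t ≤ 1 := by
    have h' : (((bondT i.D).dist s t : ℕ) : ℝ) ≤ 1 := h
    exact_mod_cast h'
  rcases Nat.le_one_iff_eq_zero_or_eq_one.1 hnat with h0 | h1
  · rw [(hreach.dist_eq_zero_iff).1 h0, dist_self]; positivity
  · have h := dist_posT_le_of_touchT (D := (toKT i).D) (bondT_adj.1 (SimpleGraph.dist_eq_one_iff_adj.1 h1)).2
    rwa [Nat.cast_pow] at h

/-- ★ **COVERAGE**: at every site some index bond OF THE LEVEL OF THE SITE has tent `1` — the faithful block map of `B9IndexBondFaithful.exists_faithful_kIdx`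
sends the fine bond `⟨z, e₀⟩` to an index bond of level `lev z` whose carrier block is the block of `z` or touches it, so `z` is within `(L^j − 1)∕2 + L^j ≤ 2L^j`
of its centre (ORPHAN blocks — `B9GlobReadingOrphan` — are covered by their neighbours' tents). [cite: Balaban1984PropagatorsII, (2.45)–(2.46) p.231; Balaban1985BackgroundPropagators, (3.43) p.398] -/
theorem exists_tent_eq_one (z : SiteY i) : ∃ y : IBondY i, lvl i.hN i.D i.hk y = Node00.levY i z ∧ tent i y z = 1 := by
  obtain ⟨bI, hlev, -, hβ1⟩ := B9IndexBondFaithful.exists_faithful_kIdx i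
  refine ⟨sIK i bI z, (B9CoReadingCoordsS.sIK_level i hlev z).trans (levY_eq_blkOf i z).symm, tent_eq_one_of_rad_le i ?_⟩
  have hl : lvl i.hN i.D i.hk (sIK i bI z) = (blkOf i.D.toDomains z).1.1 := B9CoReadingCoordsS.sIK_level i hlev z
  have h1 : (geomT i.D).dist (β i.hN i.D i.hk (sIK i bI z)) (blkOf i.D.toDomains z) ≤ 1 := by
    have := hβ1 ⟨(B6GlobalChartV1.boxEquiv i.hN).symm z, 0⟩
    rwa [blkV1_site] at this
  have hpos := dist_posT_le_of_dist_le_one i h1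
  have hmax : max (β i.hN i.D i.hk (sIK i bI z)).1.1 (blkOf i.D.toDomains z).1.1 = lvl i.hN i.D i.hk (sIK i bI z) := by
    rw [beta_level i.hN i.D i.hk (one_le_k i), ← hl, max_self]
  rw [hmax] at hpos
  have hsite := dist_site_posT_le (D := (toKT i).D) (rfl : blkOf (toKT i).D.toDomains z = blkOf (toKT i).D.toDomains z)
  rw [Nat.cast_pow] at hsite
  have hsl : (((ℓ + 1 : ℕ) : ℝ)) ^ (blkOf (toKT i).D.toDomains z).1.1 = scl i (sIK i bI z) := by rw [scl, hl]; rfl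
  rw [hsl] at hsite
  have hs := scl_pos i (sIK i bI z)
  rw [rad, div_le_iff₀ hs]
  calc dist (pt i z) (ctr i (sIK i bI z)) ≤ dist (pt i z) (posT (toKT i).D (blkOf (toKT i).D.toDomains z)) +
        dist (posT (toKT i).D (β i.hN i.D i.hk (sIK i bI z))) (posT (toKT i).D (blkOf (toKT i).D.toDomains z)) := dist_triangle_right _ _ _
    _ ≤ (scl i (sIK i bI z) - 1) / 2 + scl i (sIK i bI z) := add_le_add hsite hpos
    _ ≤ 2 * scl i (sIK i bI z) := by linarith

/-- **THE TOTAL TENT MASS** at a site: `Σ_y tent i y z`. [cite: Balaban1984PropagatorsII, (2.51) p.232 («Σ_y Δ(y) = I»), dictionary] -/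
def tot (z : SiteY i) : ℝ := ∑ y : IBondY i, tent i y z

/-- ★ `1 ≤ tot` (coverage). [cite: Balaban1984PropagatorsII, (2.51) p.232; Balaban1985BackgroundPropagators, (3.43) p.398] -/
theorem one_le_tot (z : SiteY i) : 1 ≤ tot i z := by
  obtain ⟨y, -, hy⟩ := exists_tent_eq_one i z
  rw [tot, ← hy]
  exact Finset.single_le_sum (fun y' _ => tent_nonneg i y' z) (Finset.mem_univ y)

/-- `0 < tot`. [cite: Balaban1984PropagatorsII, (2.51) p.232, bookkeeping] -/
theorem tot_pos (z : SiteY i) : 0 < tot i z := lt_of_lt_of_le zero_lt_one (one_le_tot i z)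

end Coverage

/-! ## §5 The partition of unity -/

section Partition

variable (i : KIdx d ℓ hd hL b₀ b₁)

/-- ★★ **THE MULTISCALE SMOOTH PARTITION OF UNITY** `ζ_y(z) = tent_y(z) ∕ Σ_{y′} tent_{y′}(z)`, indexed by the index bonds.
[cite: Balaban1985BackgroundPropagators, (3.43)–(3.45) p.398 («ζ ∈ C₀^∞(Δ̃(y))»); Balaban1984PropagatorsII, (2.51)–(2.52) p.232 («Σ_y Δ(y) = I»), p.239 («ζ_□ ∈ C₀^∞(□̃)»)] -/
def zeta (y : IBondY i) (z : SiteY i) : ℝ := tent i y z / tot i z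

/-- ★ `Σ_y ζ_y = 1`. [cite: Balaban1984PropagatorsII, (2.51) p.232 («Σ_y Δ(y) = I»)] -/
theorem sum_zeta (z : SiteY i) : ∑ y : IBondY i, zeta i y z = 1 := by
  unfold zeta
  rw [← Finset.sum_div, ← tot, div_self (tot_pos i z).ne']

/-- `Σ_y ζ_y = 1` over `Finset.univ` of ANY `Fintype` structure on the index bonds — the block-norm geometries `toB6 (geo9K i) R H` of the N06 lane carry their
own instance hypothesis `[Fintype (geo9K i).Site]`, and this is the form their `sum_cut`∕`hsum` binders elaborate to. [cite: Balaban1984PropagatorsII, (2.51) p.232, bookkeeping] -/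
theorem sum_zeta_of_fintype (inst : Fintype (IBondY i)) (z : SiteY i) : (@Finset.univ (IBondY i) inst).sum (fun y => zeta i y z) = 1 := by
  convert sum_zeta i z

/-- `0 ≤ ζ`. [cite: Balaban1985BackgroundPropagators, (3.43) p.398, bookkeeping] -/
theorem zeta_nonneg (y : IBondY i) (z : SiteY i) : 0 ≤ zeta i y z := div_nonneg (tent_nonneg i y z) (tot_pos i z).le

/-- `ζ ≤ 1`. [cite: Balaban1985BackgroundPropagators, (3.43) p.398, bookkeeping] -/
theorem zeta_le_one (y : IBondY i) (z : SiteY i) : zeta i y z ≤ 1 :=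
  (div_le_one (tot_pos i z)).2 ((tent_le_one i y z).trans (one_le_tot i z))

/-- `ζ_y ≤ tent_y` (the total mass is `≥ 1`). [cite: Balaban1985BackgroundPropagators, (3.43) p.398, bookkeeping] -/
theorem zeta_le_tent (y : IBondY i) (z : SiteY i) : zeta i y z ≤ tent i y z :=
  div_le_self (tent_nonneg i y z) (one_le_tot i z)

/-- **THE ENLARGED BLOCK `Δ̃(y)` AS A NEIGHBOURHOOD PREDICATE**: radial coordinate `< 3` (within `3L^{j(y)}` of the centre of `β y` on the torus).
[cite: Balaban1985BackgroundPropagators, (3.40) p.397 + (3.43) p.398 («Δ̃(y)»), dictionary] -/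
def NearY (y : IBondY i) (z : SiteY i) : Prop := rad i y z < 3

/-- ★ `ζ_y` vanishes off `Δ̃(y)`. [cite: Balaban1985BackgroundPropagators, (3.43) p.398 («ζ ∈ C₀^∞(Δ̃(y))»)] -/
theorem zeta_eq_zero_of_not_nearY {y : IBondY i} {z : SiteY i} (h : ¬ NearY i y z) : zeta i y z = 0 := by
  have ht : tent i y z = 0 := by
    by_contra hne; exact h (rad_lt_three_of_tent_ne_zero i hne)
  rw [zeta, ht, zero_div]

/-- `ζ_y(z) ≠ 0 ⇒ z ∈ Δ̃(y)`. [cite: Balaban1985BackgroundPropagators, (3.43) p.398, bookkeeping] -/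
theorem nearY_of_zeta_ne_zero {y : IBondY i} {z : SiteY i} (h : zeta i y z ≠ 0) : NearY i y z := by
  by_contra hn; exact h (zeta_eq_zero_of_not_nearY i hn)

/-- the sites of the carrier block lie in `Δ̃(y)` (radial coordinate `≤ 1∕2`). [cite: Balaban1985BackgroundPropagators, (3.43) p.398, bookkeeping] -/
theorem nearY_of_blkOf_eq {y : IBondY i} {z : SiteY i} (hz : blkOf i.D.toDomains z = β i.hN i.D i.hk y) : NearY i y z := by
  have h := dist_site_posT_le (D := (toKT i).D) hz
  rw [beta_level i.hN i.D i.hk (one_le_k i) y, Nat.cast_pow] at h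
  have hs := scl_pos i y
  show dist (pt i z) (ctr i y) / scl i y < 3
  rw [div_lt_iff₀ hs]
  exact lt_of_le_of_lt h (by rw [scl] at hs ⊢; linarith)

/-- on `Δ̃(y)` the level of a site is `j(y) − 1`, `j(y)` or `j(y) + 1`. [cite: Balaban1984PropagatorsII, (2.2) p.224; Balaban1985BackgroundPropagators, (3.40) p.397] -/
theorem levY_window_of_nearY {y : IBondY i} {z : SiteY i} (h : NearY i y z) :
    lvl i.hN i.D i.hk y ≤ Node00.levY i z + 1 ∧ Node00.levY i z ≤ lvl i.hN i.D i.hk y + 1 :=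
  levY_window_of_rad_le i (le_trans (le_of_lt h) (by norm_num))

/-- ★ a site of `Δ̃(y)` is within torus distance `7∕2·L^{j(y)}` of a site of the carrier block `β y` (for the enlargement adapters of the producers).
[cite: Balaban1985BackgroundPropagators, (3.43) p.398 («Δ̃(y)»); Balaban1984PropagatorsII, (2.46) p.231] -/
theorem exists_site_of_nearY {y : IBondY i} {z : SiteY i} (h : NearY i y z) :
    ∃ t : SiteY i, blkOf i.D.toDomains t = β i.hN i.D i.hk y ∧ Node00.levY i t = lvl i.hN i.D i.hk y ∧
      torusSupNorm (toKT i).NB (z.1 - t.1) ≤ 7 / 2 * scl i y := by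
  obtain ⟨t, hbt, hlt, hdt⟩ := exists_site_of_rad_le i (le_of_lt h)
  exact ⟨t, hbt, hlt, hdt.trans (le_of_eq (by ring))⟩

/-! ### The pull-back to a carrier with a site projection (e.g. n06-d's `XSK κ i`, `π = Prod.fst`) -/

variable {X : Type} (π : X → SiteY i)

/-- the partition read on a carrier `X` through its site projection `π`. [cite: Balaban1985BackgroundPropagators, (3.41)–(3.43) pp.397–398, dictionary] -/
def zetaOn (y : IBondY i) (x : X) : ℝ := zeta i y (π x)

/-- `Σ_y ζ_y = 1` on the carrier. [cite: Balaban1984PropagatorsII, (2.51) p.232] -/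
theorem sum_zetaOn (x : X) : ∑ y : IBondY i, zetaOn i π y x = 1 := sum_zeta i (π x)

/-- `Σ_y ζ_y = 1` on the carrier, over `Finset.univ` of any `Fintype` structure on the index bonds (the `hsum` binder of `B11SectGSmoothCut.BlockNorm.ofSmoothPartition`
at `g := toB6 (geo9K i) R H`). [cite: Balaban1984PropagatorsII, (2.51) p.232, bookkeeping] -/
theorem sum_zetaOn_of_fintype (inst : Fintype (IBondY i)) (x : X) : (@Finset.univ (IBondY i) inst).sum (fun y => zetaOn i π y x) = 1 :=
  sum_zeta_of_fintype i inst (π x)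

/-- `0 ≤ ζ` on the carrier. [cite: Balaban1985BackgroundPropagators, (3.43) p.398, bookkeeping] -/
theorem zetaOn_nonneg (y : IBondY i) (x : X) : 0 ≤ zetaOn i π y x := zeta_nonneg i y (π x)

/-- `ζ ≤ 1` on the carrier. [cite: Balaban1985BackgroundPropagators, (3.43) p.398, bookkeeping] -/
theorem zetaOn_le_one (y : IBondY i) (x : X) : zetaOn i π y x ≤ 1 := zeta_le_one i y (π x)

/-- `ζ_y` vanishes off `π⁻¹ Δ̃(y)` (the `hsupp` binder of `B11SectGSmoothCut.BlockNorm.ofSmoothPartition` with `N y x := NearY i y (π x)`).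
[cite: Balaban1985BackgroundPropagators, (3.43) p.398] -/
theorem zetaOn_eq_zero_of_not_nearY (y : IBondY i) (x : X) (h : ¬ NearY i y (π x)) : zetaOn i π y x = 0 :=
  zeta_eq_zero_of_not_nearY i h

end Partition

end Literature.MathematicalPhysics.QuantumFieldTheory.Balaban1983to89.B9MultiscaleSmoothPartitionY
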